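import Mathlib
import Literature.Analysis.UnboundedOperators.HeatKernelHeatEquation
import Literature.Analysis.UnboundedOperators.HeatFlowCalculus
import HarnessLib

/-!
# Crux `MarginalStabilityChain.StrainedLayerLaw` (stmt-AnomalousDissipation-3007),
# line `FirstLemmasR2K4`: calculus of the strained caloric map
# (stub `stub_strainedCaloricCalculus`)

Let `H(σ, x) := e^{σΔ} g (x)` be the caloric extension of compactly supported `C²` data `g` on
the real line (`Literature.Analysis.UnboundedOperators.heatExtension`; it solves
`∂_σ H = ∂ₓₓ H` for `σ > 0`), let `s(t) := ν (e^{2γt} - 1) / (2γ)` be the strain clock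
(`s(t) > 0` for `t > 0`, `s'(t) = ν e^{2γt}`) and `P(t, y) := H(s(t), e^{γt} y)` the
**strained shear diffusion** (Majda–Bertozzi 2002, §1.4, eq. (1.34)). We prove

* `contDiffOn_strainedCaloric`: `P` is jointly `C²` on `{t > 0} × ℝ` (composition of the
  jointly smooth `H` with the smooth map `(t, y) ↦ (s(t), e^{γt} y)`);
* `deriv_strainedCaloric_eq`: the PDE `P_t = γ y P_y + ν P_yy` for `t > 0` (chain rule:
  `P_t = s' H_σ + γ y e^{γt} H_x`, `P_y = e^{γt} H_x`, `P_yy = e^{2γt} H_xx`, and the heat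
  equation);

packaged as the registered stub `stub_strainedCaloricCalculus`.
-/

noncomputable section

open scoped Topology
open Filter Set Function MeasureTheory

set_option linter.dupNamespace false

namespace Summit.AnomalousDissipation.AnomalousDissipation.Theorems.StrainedLayerLaw.ParallelRelax

open Literature.Analysis.UnboundedOperators

/-! ## One-variable calculus -/

/-- `d/dy f(c y) = c f'(c y)` (no differentiability needed). [folklore] -/
theorem deriv_comp_const_mul (f : ℝ → ℝ) (c y : ℝ) :
    deriv (fun s => f (c * s)) y = c * deriv f (c * y) := by
  have h := deriv_comp_mul_left c f y
  rwa [smul_eq_mul] at h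

/-- `d²/dy² f(c y) = c² f''(c y)` (no differentiability needed). [folklore] -/
theorem deriv_deriv_comp_const_mul (f : ℝ → ℝ) (c y : ℝ) :
    deriv (fun s => deriv (fun r => f (c * r)) s) y = c * c * deriv (deriv f) (c * y) := by
  have h1 : (fun s => deriv (fun r => f (c * r)) s) = fun s => c * deriv f (c * s) :=
    funext fun s => deriv_comp_const_mul f c s
  rw [h1, deriv_const_mul_field, deriv_comp_const_mul (deriv f) c y, mul_assoc]

/-- The strain clock `s(t) = ν (e^{2γt} - 1) / (2γ)` is positive for `t > 0`. [folklore] -/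
theorem strainClock_pos {γ ν t : ℝ} (hγ : 0 < γ) (hν : 0 < ν) (ht : 0 < t) :
    0 < ν * (Real.exp (2 * γ * t) - 1) / (2 * γ) := by
  have h1 : 1 < Real.exp (2 * γ * t) := Real.one_lt_exp_iff.2 (by positivity)
  have h2 : 0 < Real.exp (2 * γ * t) - 1 := by linarith
  positivity

/-- `s'(t) = ν e^{2γt}` for the strain clock `s(t) = ν (e^{2γt} - 1) / (2γ)`, `γ ≠ 0`.
[folklore] -/
theorem hasDerivAt_strainClock {γ : ℝ} (ν t : ℝ) (hγ : γ ≠ 0) :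
    HasDerivAt (fun τ => ν * (Real.exp (2 * γ * τ) - 1) / (2 * γ))
      (ν * Real.exp (2 * γ * t)) t := by
  have h1 : HasDerivAt (fun τ => 2 * γ * τ) (2 * γ) t := by
    simpa using (hasDerivAt_id' t).const_mul (2 * γ)
  refine (((h1.exp.sub_const 1).const_mul ν).div_const (2 * γ)).congr_deriv ?_
  field_simp

/-- `d/dτ (e^{γτ} y) = γ e^{γt} y`. [folklore] -/
theorem hasDerivAt_exp_mul_const (γ y t : ℝ) :
    HasDerivAt (fun τ => Real.exp (γ * τ) * y) (γ * Real.exp (γ * t) * y) t := by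
  have h1 : HasDerivAt (fun τ => γ * τ) γ t := by
    simpa using (hasDerivAt_id' t).const_mul γ
  refine (h1.exp.mul_const y).congr_deriv ?_
  ring

/-! ## Chain rule for the caloric extension along a curve -/

/-- **Chain rule along a curve for the caloric extension on the real line.** For `g ∈ C²_c(ℝ)`
and differentiable `a, b` with `a(t) > 0`,
`d/dτ [e^{a(τ)Δ} g (b(τ))] (t) = a'(t) (e^{a(t)Δ}g)''(b(t)) + b'(t) (e^{a(t)Δ}g)'(b(t))`
(joint smoothness of `(σ, x) ↦ e^{σΔ}g(x)` on `(0, ∞) × ℝ`, the heat equation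
`∂_σ e^{σΔ} g = Δ e^{σΔ} g`, and `Δ = d²/dx²` on `ℝ`). [folklore] -/
theorem hasDerivAt_heatExtension_along {g : ℝ → ℝ} (hg : ContDiff ℝ 2 g)
    (hc : HasCompactSupport g) {a b : ℝ → ℝ} {a' b' t : ℝ} (ha : HasDerivAt a a' t)
    (hb : HasDerivAt b b' t) (hat : 0 < a t) :
    HasDerivAt (fun τ => heatExtension g (a τ) (b τ))
      (a' * deriv (deriv (heatExtension g (a t))) (b t) +
        b' * deriv (heatExtension g (a t)) (b t)) t := by
  -- joint smoothness of `H (σ, x) = e^{σΔ} g (x)` on `(0, ∞) × ℝ`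
  have hH : ContDiffOn ℝ 1 (fun q : ℝ × ℝ => heatExtension g q.1 q.2) (Ioi 0 ×ˢ univ) :=
    contDiffOn_uncurry_heatExtension (m := 1) hg.continuous.locallyIntegrable hc
  have hq : (a t, b t) ∈ Ioi (0 : ℝ) ×ˢ (univ : Set ℝ) := ⟨hat, mem_univ _⟩
  have hHd : HasFDerivAt (fun q : ℝ × ℝ => heatExtension g q.1 q.2)
      (fderiv ℝ (fun q : ℝ × ℝ => heatExtension g q.1 q.2) (a t, b t)) (a t, b t) :=
    ((hH.differentiableOn one_ne_zero).differentiableAt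
      ((isOpen_Ioi.prod isOpen_univ).mem_nhds hq)).hasFDerivAt
  set L : ℝ × ℝ →L[ℝ] ℝ :=
    fderiv ℝ (fun q : ℝ × ℝ => heatExtension g q.1 q.2) (a t, b t) with hL
  -- the `σ`-partial is the second space derivative (heat equation)
  have hLσ : L (1, 0) = deriv (deriv (heatExtension g (a t))) (b t) := by
    have h1 : HasDerivAt (fun σ => heatExtension g σ (b t)) (L (1, 0)) (a t) :=
      hHd.comp_hasDerivAt_of_eq (a t)
        ((hasDerivAt_id' (a t)).prodMk (hasDerivAt_const (a t) (b t))) rfl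
    rw [h1.unique (hasDerivAt_heatExtension_time_of_hasCompactSupport hg hc hat (b t)),
      ← laplacian_heatExtension_of_hasCompactSupport hg hc (a t) (b t),
      InnerProductSpace.laplacian_eq_iteratedDeriv_real, iteratedDeriv_succ,
      iteratedDeriv_one]
  -- the `x`-partial is the space derivative
  have hLx : L (0, 1) = deriv (heatExtension g (a t)) (b t) := by
    have h1 : HasDerivAt (heatExtension g (a t)) (L (0, 1)) (b t) :=
      hHd.comp_hasDerivAt_of_eq (b t)
        ((hasDerivAt_const (b t) (a t)).prodMk (hasDerivAt_id' (b t))) rfl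
    exact h1.deriv.symm
  -- chain rule along `τ ↦ (a τ, b τ)` and linearity of `L`
  have hchain : HasDerivAt (fun τ => heatExtension g (a τ) (b τ)) (L (a', b')) t :=
    hHd.comp_hasDerivAt_of_eq t (ha.prodMk hb) rfl
  have hlin : L (a', b') = a' * L (1, 0) + b' * L (0, 1) := by
    have h : ((a', b') : ℝ × ℝ) =
        a' • ((1 : ℝ), (0 : ℝ)) + b' • ((0 : ℝ), (1 : ℝ)) := by
      ext <;> simp
    rw [h, map_add, map_smul, map_smul, smul_eq_mul, smul_eq_mul]
  rw [hlin, hLσ, hLx] at hchain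
  exact hchain

/-! ## The strained caloric map -/

/-- **Joint `C²` regularity of the strained caloric map** `(t, y) ↦ e^{s(t)Δ} g (e^{γt} y)`,
`s(t) = ν (e^{2γt} - 1) / (2γ)`, on `{t > 0} × ℝ`, for `g ∈ C²_c(ℝ)`, `γ, ν > 0`.
[folklore] -/
theorem contDiffOn_strainedCaloric {γ ν : ℝ} {g : ℝ → ℝ} (hγ : 0 < γ) (hν : 0 < ν)
    (hg : ContDiff ℝ 2 g) (hc : HasCompactSupport g) :
    ContDiffOn ℝ 2 (fun q : ℝ × ℝ =>
        heatExtension g (ν * (Real.exp (2 * γ * q.1) - 1) / (2 * γ))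
          (Real.exp (γ * q.1) * q.2))
      (Set.Ioi 0 ×ˢ Set.univ) := by
  have hH : ContDiffOn ℝ 2 (fun q : ℝ × ℝ => heatExtension g q.1 q.2) (Ioi 0 ×ˢ univ) :=
    contDiffOn_uncurry_heatExtension (m := 2) hg.continuous.locallyIntegrable hc
  have hΦ : ContDiff ℝ 2 (fun q : ℝ × ℝ =>
      (ν * (Real.exp (2 * γ * q.1) - 1) / (2 * γ), Real.exp (γ * q.1) * q.2)) := by
    fun_prop
  have hmaps : MapsTo (fun q : ℝ × ℝ =>
      (ν * (Real.exp (2 * γ * q.1) - 1) / (2 * γ), Real.exp (γ * q.1) * q.2))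
      (Ioi 0 ×ˢ univ) (Ioi (0 : ℝ) ×ˢ (univ : Set ℝ)) := by
    rintro ⟨t, y⟩ ⟨ht, -⟩
    exact ⟨strainClock_pos hγ hν ht, mem_univ _⟩
  exact hH.comp hΦ.contDiffOn hmaps

/-- **The strained shear diffusion PDE.** For `g ∈ C²_c(ℝ)`, `γ, ν > 0` and `t > 0`, the map
`P(t, y) = e^{s(t)Δ} g (e^{γt} y)`, `s(t) = ν (e^{2γt} - 1) / (2γ)`, satisfies
`P_t = γ y P_y + ν P_yy` (Majda–Bertozzi 2002, §1.4, eq. (1.34)). [folklore] -/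
theorem deriv_strainedCaloric_eq {γ ν : ℝ} {g : ℝ → ℝ} (hγ : 0 < γ) (hν : 0 < ν)
    (hg : ContDiff ℝ 2 g) (hc : HasCompactSupport g) {t : ℝ} (y : ℝ) (ht : 0 < t) :
    deriv (fun τ => heatExtension g (ν * (Real.exp (2 * γ * τ) - 1) / (2 * γ))
        (Real.exp (γ * τ) * y)) t =
      γ * y * deriv (fun s => heatExtension g (ν * (Real.exp (2 * γ * t) - 1) / (2 * γ))
        (Real.exp (γ * t) * s)) y +
      ν * deriv (fun s => deriv (fun r =>
        heatExtension g (ν * (Real.exp (2 * γ * t) - 1) / (2 * γ))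
          (Real.exp (γ * t) * r)) s) y := by
  have h := hasDerivAt_heatExtension_along hg hc (hasDerivAt_strainClock ν t hγ.ne')
    (hasDerivAt_exp_mul_const γ y t) (strainClock_pos hγ hν ht)
  rw [h.deriv, deriv_comp_const_mul, deriv_deriv_comp_const_mul]
  have hexp : Real.exp (2 * γ * t) = Real.exp (γ * t) * Real.exp (γ * t) := by
    rw [← Real.exp_add]; ring_nf
  rw [hexp]
  ring

/-- Registered stub `stub_strainedCaloricCalculus` of line `FirstLemmasR2K4` (parallel-relaxation
package): joint `C²` regularity on `{t > 0} × ℝ` and the PDE `P_t = γ y P_y + ν P_yy` of the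
strained caloric map `P(t, y) = e^{s(t)Δ} g (e^{γt} y)`, `s(t) = ν (e^{2γt} - 1) / (2γ)`.
[folklore] -/
theorem stub_strainedCaloricCalculus :
    ∀ (γ ν : ℝ) (g : ℝ → ℝ), 0 < γ → 0 < ν → ContDiff ℝ 2 g →
      HasCompactSupport g →
      ContDiffOn ℝ 2 (fun q : ℝ × ℝ =>
        heatExtension g (ν * (Real.exp (2 * γ * q.1) - 1) / (2 * γ))
          (Real.exp (γ * q.1) * q.2))
        (Set.Ioi 0 ×ˢ Set.univ) ∧
      ∀ t y : ℝ, 0 < t →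
        deriv (fun τ => heatExtension g (ν * (Real.exp (2 * γ * τ) - 1) / (2 * γ))
          (Real.exp (γ * τ) * y)) t =
          γ * y * deriv (fun s => heatExtension g (ν * (Real.exp (2 * γ * t) - 1) / (2 * γ))
            (Real.exp (γ * t) * s)) y +
          ν * deriv (fun s => deriv (fun r =>
            heatExtension g (ν * (Real.exp (2 * γ * t) - 1) / (2 * γ))
              (Real.exp (γ * t) * r)) s) y :=
  fun _γ _ν _g hγ hν hg hc =>
    ⟨contDiffOn_strainedCaloric hγ hν hg hc,
      fun _t y ht => deriv_strainedCaloric_eq hγ hν hg hc y ht⟩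

end Summit.AnomalousDissipation.AnomalousDissipation.Theorems.StrainedLayerLaw.ParallelRelax

end
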